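import Mathlib
import Summits.AtomisticToContinuum.HydrodynamicLimit.Theorems.OneFlightGossipEngineOneFlightLayeredChaosCoarsePast
import HarnessLib

/-!
# `OneFlightGossipEngine.OneFlightLayeredChaos` — the short-gap event is measurable on the good set
(crux stmt-AtomisticToContinuum-14535, line Sketch, stub `stub_measurableSet_gap_le`)

Line Sketch splits the crux by the GAP `|s_i − s_j|` between the two flight-start snapshots of the `n`-th collision
of the tagged particle `i`: `s_i = flightStart G ε (orbit of z) 0 i (t_n z)` and `s_j` the same with the
data-dependent partner index `Φ.nthPartnerOf i n z`, `t_n = Φ.nthCollisionTimeOf i n z`. The sorry-free composition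
of the line needs the short-gap event `{|s_i − s_j| ≤ c}` to be measurable on the good set `Φ.good` of the abstract
flow. Both flight starts restricted to `Φ.good` are measurable (file `…CoarsePast`:
`measurable_flightStart_nthCollisionTimeOf_restrict`, `measurable_flightStart_partner_restrict`), hence so is the
absolute difference; the event is the image under `Subtype.val` of a sublevel set of that function, measurable by
`MeasurableSet.subtype_image`. No new definitions.
-/

open MeasureTheory Set Filter Topology
open Literature.Analysis.FluidPDE

namespace Summit.AtomisticToContinuum.HydrodynamicLimit.Theorems

/-- The gap `|s_i − s_j|` between the flight start of `i` and the flight start of its (data-dependent) partner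
before the `n`-th collision time of `i`, restricted to the good set, is measurable. [folklore] -/
theorem measurable_flightStart_gap_restrict {d : Type*} [Fintype d] {N : ℕ} {ε : ℝ}
    (Φ : HardSphereFlow (Torus.geometry d) ε N) (i : Fin N) (n : ℕ) :
    Measurable fun z : Φ.good =>
      |flightStart (Torus.geometry d) ε (fun t => Φ.flow t (z : Config N d (UnitAddTorus d))) 0 i
          (Φ.nthCollisionTimeOf i n (z : Config N d (UnitAddTorus d))) -
        flightStart (Torus.geometry d) ε (fun t => Φ.flow t (z : Config N d (UnitAddTorus d))) 0
          (Φ.nthPartnerOf i n (z : Config N d (UnitAddTorus d)))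
          (Φ.nthCollisionTimeOf i n (z : Config N d (UnitAddTorus d)))| :=
  continuous_abs.measurable.comp
    ((measurable_flightStart_nthCollisionTimeOf_restrict Φ i i n).sub
      (measurable_flightStart_partner_restrict Φ i n))

/-- **The short-gap event is measurable on the good set**: for every threshold `c`, the set of good initial data
whose two flight-start snapshots of the `n`-th collision of `i` are at most `c` apart is measurable. [folklore] -/
theorem stub_measurableSet_gap_le {d : Type*} [Fintype d] {N : ℕ} {ε : ℝ}
    (Φ : HardSphereFlow (Torus.geometry d) ε N) (i : Fin N) (n : ℕ) (c : ℝ) :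
    MeasurableSet (Φ.good ∩ {z : Config N d (UnitAddTorus d) |
      |flightStart (Torus.geometry d) ε (fun t => Φ.flow t z) 0 i (Φ.nthCollisionTimeOf i n z) -
        flightStart (Torus.geometry d) ε (fun t => Φ.flow t z) 0 (Φ.nthPartnerOf i n z)
          (Φ.nthCollisionTimeOf i n z)| ≤ c}) := by
  have hrepr : Φ.good ∩ {z : Config N d (UnitAddTorus d) |
      |flightStart (Torus.geometry d) ε (fun t => Φ.flow t z) 0 i (Φ.nthCollisionTimeOf i n z) -
        flightStart (Torus.geometry d) ε (fun t => Φ.flow t z) 0 (Φ.nthPartnerOf i n z)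
          (Φ.nthCollisionTimeOf i n z)| ≤ c} =
    Subtype.val '' ((fun z : Φ.good =>
      |flightStart (Torus.geometry d) ε (fun t => Φ.flow t (z : Config N d (UnitAddTorus d))) 0 i
          (Φ.nthCollisionTimeOf i n (z : Config N d (UnitAddTorus d))) -
        flightStart (Torus.geometry d) ε (fun t => Φ.flow t (z : Config N d (UnitAddTorus d))) 0
          (Φ.nthPartnerOf i n (z : Config N d (UnitAddTorus d)))
          (Φ.nthCollisionTimeOf i n (z : Config N d (UnitAddTorus d)))|) ⁻¹' Iic c) := by
    ext z
    simp only [mem_inter_iff, mem_setOf_eq, mem_image, mem_preimage, mem_Iic, Subtype.exists, exists_and_right,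
      exists_eq_right]
    constructor
    · rintro ⟨hz, h⟩; exact ⟨hz, h⟩
    · rintro ⟨hz, h⟩; exact ⟨hz, h⟩
  rw [hrepr]
  exact Φ.measurableSet_good.subtype_image (measurable_flightStart_gap_restrict Φ i n measurableSet_Iic)

end Summit.AtomisticToContinuum.HydrodynamicLimit.Theorems
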